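import Mathlib
import Summits.Ventures.PercRepro2.SwGlue
import Summits.Ventures.PercRepro2.SwGlueO
import Summits.Ventures.PercRepro2.SwGlueP2
import Summits.Ventures.PercRepro2.SwGlueP3
import Summits.Ventures.PercRepro2.SwGlueP1Main

/-!
# Row (SW) is closed under gluing at a vertex (blind cell PercRepro2, night-4 g4, 2026-08-24;
NIGHT4-SIDE.md §5′, the assembled statement)

`sw_glue_of_sides`: if row (SW) holds on both sides of a gluing (for every placement of the three
marks), it holds on the glued graph for every placement of the marks.  The twenty-seven placements
of `l, h, o` relative to the two sides and the cut vertex reduce, by the side swap `sw_glue_swap`,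
to the seven theorems `sw_glue_pendant` (P0, also with `l = c` or `o = c`), `sw_glue_sep_lo` (P1),
`sw_glue_sep_l` (P2), `sw_glue_sep_o` (P3), `sw_glue_cut_o` (P4), `sw_glue_cut_l` (P5),
`sw_glue_cut_h` (P6), and the empty case (`h = c` between `l` and `o`).  Hence (paper, by strong
induction on the number of edges) row (SW) on every finite multigraph follows from row (SW) on the
multigraphs without a cut vertex.
-/

namespace Summit.Ventures.PercRepro2

namespace Glue

open Hull LocRows

open scoped Classical

variable {V : Type*} {E₁ E₂ : Type*} {ends₁ : E₁ → Sym2 V} {ends₂ : E₂ → Sym2 V} {c : V}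
  {V₁ V₂ : Set V}

/-! ## The side swap -/

/-- Exchanging the two sides of a gluing relabels the edges by `Sum.swap`. -/
lemma cluster_glue_swap (ζ : Config (E₁ ⊕ E₂)) (v : V) :
    cluster (glue ends₁ ends₂) ζ v = cluster (glue ends₂ ends₁) (ζ ∘ Sum.swap) v := by
  ext u
  simp only [mem_cluster]
  constructor
  · intro h
    refine mem_of_conn_of_closed (ends := glue ends₁ ends₂) (ω := ζ) ?_ (mem_cluster_self _ _ _) h
    intro x hx y hxy
    refine mem_cluster_of_adj hx ?_
    rcases adj_glue_iff.1 hxy with h₁ | h₂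
    · exact adj_glue_iff.2 (Or.inr h₁)
    · exact adj_glue_iff.2 (Or.inl h₂)
  · intro h
    refine mem_of_conn_of_closed (ends := glue ends₂ ends₁) (ω := ζ ∘ Sum.swap) ?_
      (mem_cluster_self _ _ _) h
    intro x hx y hxy
    refine mem_cluster_of_adj hx ?_
    rcases adj_glue_iff.1 hxy with h₁ | h₂
    · exact adj_glue_iff.2 (Or.inr h₁)
    · exact adj_glue_iff.2 (Or.inl h₂)

/-- Relabelling twice is the identity. -/
lemma comp_swap_swap {α : Type*} (g : E₁ ⊕ E₂ → α) : (g ∘ Sum.swap) ∘ Sum.swap = g := by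
  funext e; simp [Function.comp, Sum.swap_swap]

/-- Relabelling twice is the identity (the other order of the sides). -/
lemma comp_swap_swap' {α : Type*} (g : E₂ ⊕ E₁ → α) : (g ∘ Sum.swap) ∘ Sum.swap = g := by
  funext e; simp [Function.comp, Sum.swap_swap]

/-- The gluing structure with the sides exchanged. -/
lemma IsGluing.swap (hg : IsGluing ends₁ ends₂ c V₁ V₂) : IsGluing ends₂ ends₁ c V₂ V₁ :=
  IsGluing.mk hg.c_mem₂ hg.c_mem₁ (fun x h₂ h₁ => hg.inter x h₁ h₂) hg.mem₂ hg.mem₁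

variable [Fintype E₁] [Fintype E₂] [DecidableEq E₁] [DecidableEq E₂]

/-- Membership in `tgtU` is invariant under the side swap. -/
lemma mem_tgtU_glue_swap {l h o : V} (ζ : Config (E₁ ⊕ E₂)) :
    ζ ∈ tgtU (glue ends₁ ends₂) l h {S : Set V | o ∈ S} ↔
      ζ ∘ Sum.swap ∈ tgtU (glue ends₂ ends₁) l h {S : Set V | o ∈ S} := by
  simp only [tgtU, Finset.mem_filter, Finset.mem_univ, true_and, mem_hull_iff, Set.mem_setOf_eq]
  have e1 : blue (ζ ∘ Sum.swap) = blue ζ ∘ Sum.swap := rfl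
  rw [cluster_glue_swap ζ l, cluster_glue_swap (blue ζ) l, e1]

/-- **Row (SW) is invariant under the side swap.** -/
theorem sw_glue_swap {l h o : V} (hs : Sw (glue ends₂ ends₁) l h o) :
    Sw (glue ends₁ ends₂) l h o := by
  obtain ⟨f, hf, hmem⟩ := hs
  refine ⟨fun x => f ⟨x.1 ∘ Sum.swap, (mem_tgtU_glue_swap x.1).1 x.2⟩ ∘ Sum.swap, ?_, ?_⟩
  · intro x y hxy
    have h1 : f ⟨x.1 ∘ Sum.swap, (mem_tgtU_glue_swap x.1).1 x.2⟩ =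
        f ⟨y.1 ∘ Sum.swap, (mem_tgtU_glue_swap y.1).1 y.2⟩ := by
      have this : (f ⟨x.1 ∘ Sum.swap, (mem_tgtU_glue_swap x.1).1 x.2⟩ ∘ Sum.swap) ∘ Sum.swap =
          (f ⟨y.1 ∘ Sum.swap, (mem_tgtU_glue_swap y.1).1 y.2⟩ ∘ Sum.swap) ∘ Sum.swap :=
        congrArg (fun ζ => ζ ∘ Sum.swap) hxy
      rwa [comp_swap_swap', comp_swap_swap'] at this
    have h2 : x.1 ∘ Sum.swap = y.1 ∘ Sum.swap := congrArg Subtype.val (hf h1)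
    apply Subtype.ext
    have this : (x.1 ∘ Sum.swap) ∘ Sum.swap = (y.1 ∘ Sum.swap) ∘ Sum.swap :=
      congrArg (fun ζ => ζ ∘ Sum.swap) h2
    rwa [comp_swap_swap, comp_swap_swap] at this
  · intro x
    obtain ⟨ht, hsub⟩ := hmem ⟨x.1 ∘ Sum.swap, (mem_tgtU_glue_swap x.1).1 x.2⟩
    refine ⟨?_, ?_⟩
    · rw [mem_tgtU_glue_swap, comp_swap_swap']
      exact ht
    · have e2 : blue (f ⟨x.1 ∘ Sum.swap, (mem_tgtU_glue_swap x.1).1 x.2⟩ ∘ Sum.swap) =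
          blue (f ⟨x.1 ∘ Sum.swap, (mem_tgtU_glue_swap x.1).1 x.2⟩) ∘ Sum.swap := rfl
      have key : cluster (glue ends₁ ends₂)
          (blue (f ⟨x.1 ∘ Sum.swap, (mem_tgtU_glue_swap x.1).1 x.2⟩) ∘ Sum.swap) h =
          cluster (glue ends₂ ends₁) (blue (f ⟨x.1 ∘ Sum.swap, (mem_tgtU_glue_swap x.1).1 x.2⟩)) h := by
        rw [cluster_glue_swap, comp_swap_swap']
      rw [cluster_glue_swap x.1 h, e2, key]
      exact hsub

/-! ## The pendant placement with the cut vertex among the marks -/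

omit [Fintype E₁] [Fintype E₂] [DecidableEq E₁] [DecidableEq E₂] in
/-- A vertex of the first side (possibly `c`) is in the cluster of `v ∈ V₁` iff it is in the
`G₁`-cluster. -/
lemma mem_cluster_glue_iff₁' (hg : IsGluing ends₁ ends₂ c V₁ V₂) {ζ : Config (E₁ ⊕ E₂)} {v u : V}
    (hv : v ∈ V₁) (hu : u ∈ V₁) :
    u ∈ cluster (glue ends₁ ends₂) ζ v ↔ u ∈ cluster ends₁ (ζ ∘ Sum.inl) v := by
  rw [cluster_glue_eq hg hv]
  simp only [Set.mem_union, Set.mem_setOf_eq]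
  constructor
  · rintro (h | ⟨hc, h⟩)
    · exact h
    · have : u = c := hg.inter u hu (cluster_subset_of_mem₂ hg hg.c_mem₂ h)
      rw [this]; exact hc
  · exact Or.inl

/-- **(SW) with a pendant side, the cut vertex possibly among the marks**: `l, h, o ∈ V₁`
(any of them may be `c`); (SW) on the first side gives (SW) on the glued graph. -/
theorem sw_glue_pendant' {l h o : V} (hg : IsGluing ends₁ ends₂ c V₁ V₂) (hl : l ∈ V₁) (hh : h ∈ V₁)
    (ho : o ∈ V₁) (h₁ : Sw ends₁ l h o) : Sw (glue ends₁ ends₂) l h o := by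
  obtain ⟨f₁, hf₁, hmem₁⟩ := h₁
  have key : ∀ ζ : Config (E₁ ⊕ E₂),
      ζ ∈ tgtU (glue ends₁ ends₂) l h {S : Set V | o ∈ S} ↔
        ζ ∘ Sum.inl ∈ tgtU ends₁ l h {S : Set V | o ∈ S} := by
    intro ζ
    rw [mem_tgtU_glue_iff, mem_cluster_glue_iff₁' hg hl hh, mem_cluster_glue_iff₁' hg hl hh,
      mem_cluster_glue_iff₁' hg hl ho, mem_cluster_glue_iff₁' hg hl ho, blue_comp_inl]
    simp only [tgtU, Finset.mem_filter, Finset.mem_univ, true_and, mem_hull_iff, Set.mem_setOf_eq,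
      not_or]
  refine ⟨fun x => pair (f₁ ⟨x.1 ∘ Sum.inl, (key _).1 x.2⟩) (blue (x.1 ∘ Sum.inr)), ?_, ?_⟩
  · intro x y hxy
    have h1 := congrArg (fun ζ => ζ ∘ Sum.inl) hxy
    have h2 := congrArg (fun ζ => ζ ∘ Sum.inr) hxy
    simp only [pair_inl, pair_inr] at h1 h2
    have h1' : x.1 ∘ Sum.inl = y.1 ∘ Sum.inl := congrArg Subtype.val (hf₁ h1)
    have h2' : x.1 ∘ Sum.inr = y.1 ∘ Sum.inr := by
      have := congrArg blue h2
      simpa only [blue_blue] using this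
    apply Subtype.ext
    rw [← pair_comp x.1, ← pair_comp y.1, h1', h2']
  · intro x
    obtain ⟨ht, hsub⟩ := hmem₁ ⟨x.1 ∘ Sum.inl, (key _).1 x.2⟩
    refine ⟨(key _).2 (by rw [pair_inl]; exact ht), ?_⟩
    intro u hu
    rw [cluster_glue_eq hg hh] at hu
    rw [cluster_glue_eq hg hh, blue_pair, pair_inl, pair_inr, blue_blue]
    rcases hu with hu | ⟨hc, hu⟩
    · exact Or.inl (hsub hu)
    · exact Or.inr ⟨hsub hc, hu⟩

/-! ## The empty placement -/

/-- (SW) holds vacuously when `Q` is empty. -/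
lemma sw_of_empty {E : Type*} [Fintype E] [DecidableEq E] {ends : E → Sym2 V} {l h o : V}
    (he : tgtU ends l h {S : Set V | o ∈ S} = ∅) : Sw ends l h o := by
  refine ⟨fun x => x.1, fun x y hxy => Subtype.ext hxy, fun x => ?_⟩
  exact absurd x.2 (Finset.eq_empty_iff_forall_notMem.1 he x.1)

/-- **`h = c` between `l` and `o`**: `Q(G)` is empty. -/
theorem sw_glue_cut_h_between {l o : V} (hg : IsGluing ends₁ ends₂ c V₁ V₂) (hl : l ∈ V₁)
    (ho : o ∈ V₂) (hoc : o ≠ c) : Sw (glue ends₁ ends₂) l c o := by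
  apply sw_of_empty
  rw [Finset.eq_empty_iff_forall_notMem]
  intro ζ hζ
  rw [mem_tgtU_glue_iff, mem_cluster_glue_iff_across hg hl ho hoc] at hζ
  obtain ⟨⟨h1, _⟩, ⟨h3, _⟩, _⟩ := hζ
  exact h1 ((mem_cluster_glue_c_iff hg hl).2 h3)

/-! ## The assembled statement -/

/-- **Row (SW) is closed under gluing at a vertex**: if (SW) holds on both sides for every
placement of three distinct marks, it holds on the glued graph for every placement of three distinct
marks lying on the sides. -/
theorem sw_glue_of_sides (hg : IsGluing ends₁ ends₂ c V₁ V₂)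
    (hs₁ : ∀ l h o : V, l ≠ h → o ≠ l → o ≠ h → Sw ends₁ l h o)
    (hs₂ : ∀ l h o : V, l ≠ h → o ≠ l → o ≠ h → Sw ends₂ l h o)
    {l h o : V} (hlh : l ≠ h) (hol : o ≠ l) (hoh : o ≠ h)
    (hl : l ∈ V₁ ∨ l ∈ V₂) (hh : h ∈ V₁ ∨ h ∈ V₂) (ho : o ∈ V₁ ∨ o ∈ V₂) :
    Sw (glue ends₁ ends₂) l h o := by
  have hg' := hg.swap
  -- a vertex on both sides is `c`
  have both : ∀ v, v ∈ V₁ → v ∈ V₂ → v = c := hg.inter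
  by_cases hlc : l = c
  · subst hlc
    rcases hh with hh | hh <;> rcases ho with ho | ho
    · exact sw_glue_pendant' hg hg.c_mem₁ hh ho (hs₁ _ _ _ hlh hol hoh)
    · exact sw_glue_swap (sw_glue_cut_l hg' ho hol hh (Ne.symm hlh))
    · exact sw_glue_cut_l hg ho hol hh (Ne.symm hlh)
    · exact sw_glue_swap (sw_glue_pendant' hg' hg.c_mem₂ hh ho (hs₂ _ _ _ hlh hol hoh))
  by_cases hhc : h = c
  · subst hhc
    rcases hl with hl | hl <;> rcases ho with ho | ho
    · exact sw_glue_pendant' hg hl hg.c_mem₁ ho (hs₁ _ _ _ hlh hol hoh)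
    · exact sw_glue_cut_h_between hg hl ho hoh
    · exact sw_glue_swap (sw_glue_cut_h_between hg' hl ho hoh)
    · exact sw_glue_swap (sw_glue_pendant' hg' hl hg.c_mem₂ ho (hs₂ _ _ _ hlh hol hoh))
  by_cases hoc : o = c
  · subst hoc
    rcases hl with hl | hl <;> rcases hh with hh | hh
    · exact sw_glue_pendant' hg hl hh hg.c_mem₁ (hs₁ _ _ _ hlh hol hoh)
    · exact sw_glue_cut_o hg hl hh hhc
    · exact sw_glue_swap (sw_glue_cut_o hg' hl hh hhc)
    · exact sw_glue_swap (sw_glue_pendant' hg' hl hh hg.c_mem₂ (hs₂ _ _ _ hlh hol hoh))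
  rcases hl with hl | hl <;> rcases hh with hh | hh <;> rcases ho with ho | ho
  · exact sw_glue_pendant' hg hl hh ho (hs₁ _ _ _ hlh hol hoh)
  · -- `l, h ∈ V₁`, `o ∈ V₂`: `o` separated from `{l, h}`
    exact sw_glue_swap (sw_glue_sep_o hg' ho hoc hl hh hhc (hs₁ _ _ _ hlh (Ne.symm hlc) (Ne.symm hhc)))
  · -- `l, o ∈ V₁`, `h ∈ V₂`: P1
    exact sw_glue_sep_lo hg hl ho hoc hh hhc (hs₁ _ _ _ hlc hol hoc)
  · -- `l ∈ V₁`, `h, o ∈ V₂`: P2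
    exact sw_glue_sep_l hg hl hh hhc ho hoc (hs₂ _ _ _ (Ne.symm hhc) hoc hoh)
  · -- `l ∈ V₂`, `h, o ∈ V₁`: P2 swapped
    exact sw_glue_swap (sw_glue_sep_l hg' hl hh hhc ho hoc (hs₁ _ _ _ (Ne.symm hhc) hoc hoh))
  · -- `l, o ∈ V₂`, `h ∈ V₁`: P1 swapped
    exact sw_glue_swap (sw_glue_sep_lo hg' hl ho hoc hh hhc (hs₂ _ _ _ hlc hol hoc))
  · -- `l, h ∈ V₂`, `o ∈ V₁`: P3
    exact sw_glue_sep_o hg ho hoc hl hh hhc (hs₂ _ _ _ hlh (Ne.symm hlc) (Ne.symm hhc))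
  · exact sw_glue_swap (sw_glue_pendant' hg' hl hh ho (hs₂ _ _ _ hlh hol hoh))

end Glue

end Summit.Ventures.PercRepro2
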